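import Summits.CriticalPhenomena.PercolationContinuityZ3.Theorems.PercNearOneGluingNoHeavyLowerTailKNGoodGCThreeHair
import HarnessLib

/-!
# The gluing inequality GC for THREE relays — arithmetic core: hair inequalities and the two non-trivial witness cases
# (`NoHeavyLowerTail` cell, stmt-CriticalPhenomena-4575; prover `prim-hp-2`, deletion–contraction line, gen 12)

Support file (`--supports stmt-CriticalPhenomena-4575`).  No definitions, no named facts, no sorries; pure real algebra.
Memo: `run/shared/lean/prim/prim-hp-2/MEMO-gen12-gc-three-relays.md` (paper proof of GC₃ and the certificate method).

SETTING (memo §1).  `C` is any finite weighted graph containing the sink `b` and three relays `1, 2, 3`, labelled so that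
`s₁ ≤ s₂ ≤ s₃` where `s_a = P_C(a ↔ b)`; `x, y` are two pendant relay-stars with hair probabilities `x₁ x₂ x₃`, `y₁ y₂ y₃ ∈ [0,1]`;
`K = C + x + y` (separate stars), `M = C + m` with the merged star `m` of hair probabilities `H_a = x_a + y_a − x_a y_a`.
Glued-core reliabilities: `s_{aa'} = P_C(a ↔ b ∨ a' ↔ b)` (the pair `aa'` glued), `t_c = P_{C/aa'}(c ↔ b)` (the third relay, riding
the glued pair).  A pattern of the two separate stars glues `C` into one of the worlds `d, [12], [13], [23], [123]` with
probabilities `q_d = α_x α_y`, `q₁₃ = X₁₃(α_y + Y₁₃) + Y₁₃ α_x`, … where `X_B = ∏_{a∈B} x_a ∏_{a∉B} (1−x_a)` and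
`α_x = X_∅ + X₁ + X₂ + X₃` (the star `x` hits at most one port).  Kozma–Nitzan's gluing inequality GC — the hypothesis `hGC` of
`KNGoodSeries.knGood_series_of_gluing` — reads `T(a₀) := P_M(m↔b) + π₀·min_a s_a − P_M(a₀↔b) ≥ 0` for `a₀` the `K`-loneliest relay.
For `a₀ = 1` it is Kozma–Nitzan's Theorem 4.  This file proves the real-algebra heart of the two other cases:

* the hair inequalities (HI2) `(1 − H₃)·q₁₃ ≤ H₁H₃·q_d`, (HI3) `(1 − H₁H₂)·q₁₂ ≤ H₁H₂·q_d` are in the companion file `…KNGoodGCThreeHair.lean`.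
* `KNGoodGC3.gc3_middle` — case `a₀ = 2`:  from `s₁ ≤ s₂ ≤ s₃`, the exchange row `t₂ ≤ s₁₃` (KN Lemma 3(ii)), and the world expansion
  of the hypothesis `P_K(2↔b) ≤ P_K(1↔b)`, namely `0 ≤ q_d(s₁−s₂) + q₁₃(s₁₃−t₂) + q₂₃(t₁−s₂₃)` with `t₁ ≤ s₂₃`:
  `0 ≤ T(2) = (1−H₂)·[(1−H₃)(s₁−s₂) + H₃(1−H₁)(s₃−s₂) + H₁H₃(s₁₃−t₂)]`.
* `KNGoodGC3.gc3_top` — case `a₀ = 3`:  from the expansion of `P_K(3↔b) ≤ P_K(1↔b)`, `0 ≤ q_d(s₁−s₃) + q₁₂(s₁₂−t₃) + q₂₃(t₁−s₂₃)`,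
  and `s₁ = s₃ → t₃ ≤ s₁₂`:  `0 ≤ T(3) = (1−H₃)·[(1−H₂)(s₁−s₃) + H₂(1−H₁)(s₂−s₃) + H₁H₂(s₁₂−t₃)]`.
The closed forms of `T(2)`, `T(3)` are the pattern expansion of the merged one-layer observer (`KNGoodTwoTwo.agood_oneLayer_ge`);
the probabilistic assembly (identifying the forced-star reliabilities with `s_{aa'}`, `t_c`) is left to the next file.
[cite: KozmaNitzan2024, §3.2 Definition and Thms. 4–5 (pp. 12–14), Lemma 3 (pp. 6–7)]
-/

namespace Summit.CriticalPhenomena.PercolationContinuityZ3.Theorems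

namespace KNGoodGC3

/-! ### Arithmetic cores of the two witness cases -/

/-- **Arithmetic core, case `a₀ =` middle relay.**  Reals: `H₁ H₂ H₃ ∈ [0,1]` (merged hairs), `qd q₁₃ q₂₃ ≥ 0` (world weights),
`α = s₂ − s₁ ≥ 0`, `β = s₃ − s₂ ≥ 0`, `γ = s₁₃ − t₂ ≥ 0`, `δ = s₂₃ − t₁ ≥ 0`; hypothesis row `qd·α + q₂₃·δ ≤ q₁₃·γ`, hair inequality
`(1−H₃)q₁₃ ≤ H₁H₃ qd`, degeneracy bound `(1−H₂)(1−H₃) ≤ qd`.  Conclusion: `0 ≤ (1−H₂)[−(1−H₃)α + H₃(1−H₁)β + H₁H₃γ]`. [folklore] -/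
theorem gc3_middle_arith {H₁ H₂ H₃ qd q₁₃ q₂₃ α β γ δ : ℝ}
    (hH₁ : 0 ≤ H₁) (hH₁' : H₁ ≤ 1) (hH₂' : H₂ ≤ 1) (hH₃ : 0 ≤ H₃) (hH₃' : H₃ ≤ 1)
    (hqd : 0 ≤ qd) (hq₁₃ : 0 ≤ q₁₃) (hq₂₃ : 0 ≤ q₂₃) (hα : 0 ≤ α) (hβ : 0 ≤ β) (hγ : 0 ≤ γ) (hδ : 0 ≤ δ)
    (hyp : qd * α + q₂₃ * δ ≤ q₁₃ * γ) (hair : (1 - H₃) * q₁₃ ≤ H₁ * H₃ * qd) (hdeg : (1 - H₂) * (1 - H₃) ≤ qd) :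
    0 ≤ (1 - H₂) * (-((1 - H₃) * α) + H₃ * (1 - H₁) * β + H₁ * H₃ * γ) := by
  have hpos : 0 ≤ (1 - H₂) * (H₃ * (1 - H₁) * β) := mul_nonneg (by linarith) (mul_nonneg (mul_nonneg hH₃ (by linarith)) hβ)
  have hH13 : 0 ≤ H₁ * H₃ := mul_nonneg hH₁ hH₃
  have hyp' : qd * α ≤ q₁₃ * γ := by nlinarith [mul_nonneg hq₂₃ hδ]
  by_cases hq : 0 < q₁₃
  · -- `q₁₃ (1−H₃) α ≤ H₁H₃ qd α ≤ H₁H₃ q₁₃ γ`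
    have h1 : q₁₃ * ((1 - H₃) * α) ≤ H₁ * H₃ * qd * α := by
      have := mul_le_mul_of_nonneg_right hair hα
      linarith [this]
    have h2 : H₁ * H₃ * qd * α ≤ H₁ * H₃ * (q₁₃ * γ) := by
      have := mul_le_mul_of_nonneg_left hyp' hH13
      linarith [this]
    have h3 : q₁₃ * ((1 - H₃) * α) ≤ q₁₃ * (H₁ * H₃ * γ) := by linarith
    have key : (1 - H₃) * α ≤ H₁ * H₃ * γ := le_of_mul_le_mul_left h3 hq
    have : 0 ≤ (1 - H₂) * (-((1 - H₃) * α) + H₁ * H₃ * γ) := mul_nonneg (by linarith) (by linarith)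
    nlinarith
  · have hq0 : q₁₃ = 0 := le_antisymm (not_lt.1 hq) hq₁₃
    rw [hq0, zero_mul] at hyp'
    have h0 : qd * α = 0 := le_antisymm hyp' (mul_nonneg hqd hα)
    have h4 : (1 - H₂) * (1 - H₃) * α ≤ qd * α := mul_le_mul_of_nonneg_right hdeg hα
    have h5 : 0 ≤ (1 - H₂) * (1 - H₃) * α := mul_nonneg (mul_nonneg (by linarith) (by linarith)) hα
    have h6 : (1 - H₂) * (1 - H₃) * α = 0 := le_antisymm (by linarith) h5
    have hg : 0 ≤ (1 - H₂) * (H₁ * H₃ * γ) := mul_nonneg (by linarith) (mul_nonneg hH13 hγ)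
    nlinarith

/-- **Arithmetic core, case `a₀ =` most reliable relay of the core.**  Reals as above with `α' = s₃ − s₁ ≥ β' = s₃ − s₂ ≥ 0`,
`γ' = s₁₂ − t₃` (any sign), `δ = s₂₃ − t₁ ≥ 0`; hypothesis row `qd·α' + q₂₃·δ ≤ q₁₂·γ'`, hair inequality `(1−H₁H₂)q₁₂ ≤ H₁H₂ qd`,
degeneracy bound `1−H₃ ≤ qd + q₁₂`, and the tie row `α' = 0 → 0 ≤ γ'`.
Conclusion: `0 ≤ (1−H₃)[−(1−H₂)α' − H₂(1−H₁)β' + H₁H₂γ']`. [folklore] -/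
theorem gc3_top_arith {H₁ H₂ H₃ qd q₁₂ q₂₃ α' β' γ' δ : ℝ}
    (hH₁ : 0 ≤ H₁) (hH₁' : H₁ ≤ 1) (hH₂ : 0 ≤ H₂) (hH₂' : H₂ ≤ 1) (hH₃' : H₃ ≤ 1)
    (hqd : 0 ≤ qd) (hq₁₂ : 0 ≤ q₁₂) (hq₂₃ : 0 ≤ q₂₃) (hα : 0 ≤ α') (hβ : 0 ≤ β') (hβα : β' ≤ α') (hδ : 0 ≤ δ)
    (hyp : qd * α' + q₂₃ * δ ≤ q₁₂ * γ') (hair : (1 - H₁ * H₂) * q₁₂ ≤ H₁ * H₂ * qd)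
    (hdeg' : 1 - H₃ ≤ qd + q₁₂) (htie : α' = 0 → 0 ≤ γ') :
    0 ≤ (1 - H₃) * (-((1 - H₂) * α') - H₂ * (1 - H₁) * β' + H₁ * H₂ * γ') := by
  have hH12 : 0 ≤ H₁ * H₂ := mul_nonneg hH₁ hH₂
  have hH12' : H₁ * H₂ ≤ 1 := mul_le_one₀ hH₁' hH₂ hH₂'
  have hyp' : qd * α' ≤ q₁₂ * γ' := by nlinarith [mul_nonneg hq₂₃ hδ]
  -- `−(1−H₂)α' − H₂(1−H₁)β' ≥ −(1−H₁H₂)α'`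
  have hlow : -((1 - H₁ * H₂) * α') ≤ -((1 - H₂) * α') - H₂ * (1 - H₁) * β' := by
    have : H₂ * (1 - H₁) * β' ≤ H₂ * (1 - H₁) * α' := mul_le_mul_of_nonneg_left hβα (mul_nonneg hH₂ (by linarith))
    nlinarith
  by_cases hq : 0 < q₁₂
  · have hγ : 0 ≤ γ' := by
      by_contra hneg
      have hneg' : γ' < 0 := not_le.1 hneg
      have : q₁₂ * γ' < 0 := mul_neg_of_pos_of_neg hq hneg'
      nlinarith [mul_nonneg hqd hα]
    have h1 : q₁₂ * ((1 - H₁ * H₂) * α') ≤ H₁ * H₂ * qd * α' := by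
      have := mul_le_mul_of_nonneg_right hair hα
      linarith [this]
    have h2 : H₁ * H₂ * qd * α' ≤ H₁ * H₂ * (q₁₂ * γ') := by
      have := mul_le_mul_of_nonneg_left hyp' hH12
      linarith [this]
    have h3 : q₁₂ * ((1 - H₁ * H₂) * α') ≤ q₁₂ * (H₁ * H₂ * γ') := by linarith
    have key : (1 - H₁ * H₂) * α' ≤ H₁ * H₂ * γ' := le_of_mul_le_mul_left h3 hq
    have : 0 ≤ (1 - H₃) * (-((1 - H₁ * H₂) * α') + H₁ * H₂ * γ') := mul_nonneg (by linarith) (by linarith)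
    nlinarith [mul_nonneg (sub_nonneg.2 hH₃') (by linarith : 0 ≤ -((1 - H₂) * α') - H₂ * (1 - H₁) * β' + (1 - H₁ * H₂) * α')]
  · have hq0 : q₁₂ = 0 := le_antisymm (not_lt.1 hq) hq₁₂
    rw [hq0, zero_mul] at hyp'
    have h0 : qd * α' = 0 := le_antisymm hyp' (mul_nonneg hqd hα)
    by_cases hd : 0 < qd
    · -- `α' = 0`, hence `β' = 0` and `γ' ≥ 0`
      have hα0 : α' = 0 := by
        rcases mul_eq_zero.1 h0 with h | h
        · exact absurd h (ne_of_gt hd)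
        · exact h
      have hβ0 : β' = 0 := le_antisymm (hα0 ▸ hβα) hβ
      have hγ := htie hα0
      rw [hα0, hβ0]
      have : 0 ≤ (1 - H₃) * (H₁ * H₂ * γ') := mul_nonneg (by linarith) (mul_nonneg hH12 hγ)
      nlinarith
    · -- `qd = q₁₂ = 0` forces `H₃ = 1`
      have hqd0 : qd = 0 := le_antisymm (not_lt.1 hd) hqd
      rw [hqd0, hq0] at hdeg'
      have hH3 : H₃ = 1 := le_antisymm hH₃' (by linarith)
      rw [hH3]; simp

/-! ### The two cases of GC₃ in closed form -/

/-- **GC for three relays, case `a₀ = 2` (the `K`-loneliest relay is the middle relay of the core), closed form.**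
Inputs: hair probabilities `x₁ x₂ x₃ y₁ y₂ y₃ ∈ [0,1]`; core reliabilities with `s₁ ≤ s₂ ≤ s₃`; the exchange rows `t₂ ≤ s₁₃`
(from `s₂ ≤ s₃`) and `t₁ ≤ s₂₃` (from `s₁ ≤ s₂`) of Kozma–Nitzan's Lemma 3(ii); the world expansion of the hypothesis
`P_K(2↔b) ≤ P_K(1↔b)`.  Conclusion: the pattern expansion `T(2)` of `P_M(m↔b) + π₀ s₁ − P_M(2↔b)` is nonnegative.
[cite: KozmaNitzan2024, §3.2 Definition and Thm. 5 (pp. 12–14) — extension to two pendant stars, three relays] -/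
theorem gc3_middle {x₁ x₂ x₃ y₁ y₂ y₃ αx αy s₁ s₂ s₃ s₁₃ s₂₃ t₁ t₂ : ℝ}
    (hx₁ : 0 ≤ x₁) (hx₁' : x₁ ≤ 1) (hx₂ : 0 ≤ x₂) (hx₂' : x₂ ≤ 1) (hx₃ : 0 ≤ x₃) (hx₃' : x₃ ≤ 1)
    (hy₁ : 0 ≤ y₁) (hy₁' : y₁ ≤ 1) (hy₂ : 0 ≤ y₂) (hy₂' : y₂ ≤ 1) (hy₃ : 0 ≤ y₃) (hy₃' : y₃ ≤ 1)
    (hαx : αx = (1 - x₁) * (1 - x₂) * (1 - x₃) + x₁ * (1 - x₂) * (1 - x₃) + (1 - x₁) * x₂ * (1 - x₃) + (1 - x₁) * (1 - x₂) * x₃)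
    (hαy : αy = (1 - y₁) * (1 - y₂) * (1 - y₃) + y₁ * (1 - y₂) * (1 - y₃) + (1 - y₁) * y₂ * (1 - y₃) + (1 - y₁) * (1 - y₂) * y₃)
    (h12 : s₁ ≤ s₂) (h23 : s₂ ≤ s₃) (hE2 : t₂ ≤ s₁₃) (hE1 : t₁ ≤ s₂₃)
    (hyp : 0 ≤ αx * αy * (s₁ - s₂) + (x₁ * (1 - x₂) * x₃ * (αy + y₁ * (1 - y₂) * y₃) + y₁ * (1 - y₂) * y₃ * αx) * (s₁₃ - t₂) +
      ((1 - x₁) * x₂ * x₃ * (αy + (1 - y₁) * y₂ * y₃) + (1 - y₁) * y₂ * y₃ * αx) * (t₁ - s₂₃)) :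
    0 ≤ (1 - (x₂ + y₂ - x₂ * y₂)) * ((1 - (x₃ + y₃ - x₃ * y₃)) * (s₁ - s₂) +
      (x₃ + y₃ - x₃ * y₃) * (1 - (x₁ + y₁ - x₁ * y₁)) * (s₃ - s₂) + (x₁ + y₁ - x₁ * y₁) * (x₃ + y₃ - x₃ * y₃) * (s₁₃ - t₂)) := by
  have hαx0 : 0 ≤ αx := by rw [hαx]; exact alpha_nonneg hx₁ hx₁' hx₂ hx₂' hx₃ hx₃'
  have hαy0 : 0 ≤ αy := by rw [hαy]; exact alpha_nonneg hy₁ hy₁' hy₂ hy₂' hy₃ hy₃'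
  have hair := hairIneq_middle hx₁ hx₁' hx₂ hx₂' hx₃ hx₃' hy₁ hy₁' hy₂ hy₂' hy₃ hy₃' hαx hαy
  have hdeg := noHit23_le_qd hx₁ hx₁' hx₂ hx₂' hx₃ hx₃' hy₁ hy₁' hy₂ hy₂' hy₃ hy₃' hαx hαy
  have hq₁₃ : 0 ≤ x₁ * (1 - x₂) * x₃ * (αy + y₁ * (1 - y₂) * y₃) + y₁ * (1 - y₂) * y₃ * αx := by
    have t1 : 0 ≤ x₁ * (1 - x₂) * x₃ * (αy + y₁ * (1 - y₂) * y₃) :=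
      mul_nonneg (mul_nonneg (mul_nonneg hx₁ (by linarith)) hx₃) (add_nonneg hαy0 (mul_nonneg (mul_nonneg hy₁ (by linarith)) hy₃))
    have t2 : 0 ≤ y₁ * (1 - y₂) * y₃ * αx := mul_nonneg (mul_nonneg (mul_nonneg hy₁ (by linarith)) hy₃) hαx0
    linarith
  have hq₂₃ : 0 ≤ (1 - x₁) * x₂ * x₃ * (αy + (1 - y₁) * y₂ * y₃) + (1 - y₁) * y₂ * y₃ * αx := by
    have t1 : 0 ≤ (1 - x₁) * x₂ * x₃ * (αy + (1 - y₁) * y₂ * y₃) :=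
      mul_nonneg (mul_nonneg (mul_nonneg (by linarith) hx₂) hx₃) (add_nonneg hαy0 (mul_nonneg (mul_nonneg (by linarith) hy₂) hy₃))
    have t2 : 0 ≤ (1 - y₁) * y₂ * y₃ * αx := mul_nonneg (mul_nonneg (mul_nonneg (by linarith) hy₂) hy₃) hαx0
    linarith
  have hH₁ : 0 ≤ x₁ + y₁ - x₁ * y₁ := merged_nonneg hx₁ hy₁ hy₁'
  have hH₁' : x₁ + y₁ - x₁ * y₁ ≤ 1 := merged_le_one hx₁' hy₁'
  have hH₂' : x₂ + y₂ - x₂ * y₂ ≤ 1 := merged_le_one hx₂' hy₂'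
  have hH₃ : 0 ≤ x₃ + y₃ - x₃ * y₃ := merged_nonneg hx₃ hy₃ hy₃'
  have hH₃' : x₃ + y₃ - x₃ * y₃ ≤ 1 := merged_le_one hx₃' hy₃'
  have hqd0 : 0 ≤ αx * αy := mul_nonneg hαx0 hαy0
  have hα : 0 ≤ s₂ - s₁ := sub_nonneg.2 h12
  have hβ : 0 ≤ s₃ - s₂ := sub_nonneg.2 h23
  have hγ : 0 ≤ s₁₃ - t₂ := sub_nonneg.2 hE2
  have hδ : 0 ≤ s₂₃ - t₁ := sub_nonneg.2 hE1
  have hyp' : αx * αy * (s₂ - s₁) +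
      ((1 - x₁) * x₂ * x₃ * (αy + (1 - y₁) * y₂ * y₃) + (1 - y₁) * y₂ * y₃ * αx) * (s₂₃ - t₁) ≤
        (x₁ * (1 - x₂) * x₃ * (αy + y₁ * (1 - y₂) * y₃) + y₁ * (1 - y₂) * y₃ * αx) * (s₁₃ - t₂) := by
    linarith [hyp]
  have core := gc3_middle_arith hH₁ hH₁' hH₂' hH₃ hH₃' hqd0 hq₁₃ hq₂₃ hα hβ hγ hδ hyp' hair hdeg
  have e : (1 - (x₂ + y₂ - x₂ * y₂)) * ((1 - (x₃ + y₃ - x₃ * y₃)) * (s₁ - s₂) +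
      (x₃ + y₃ - x₃ * y₃) * (1 - (x₁ + y₁ - x₁ * y₁)) * (s₃ - s₂) + (x₁ + y₁ - x₁ * y₁) * (x₃ + y₃ - x₃ * y₃) * (s₁₃ - t₂)) =
      (1 - (x₂ + y₂ - x₂ * y₂)) * (-((1 - (x₃ + y₃ - x₃ * y₃)) * (s₂ - s₁)) +
        (x₃ + y₃ - x₃ * y₃) * (1 - (x₁ + y₁ - x₁ * y₁)) * (s₃ - s₂) + (x₁ + y₁ - x₁ * y₁) * (x₃ + y₃ - x₃ * y₃) * (s₁₃ - t₂)) := by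
    ring
  rw [e]; exact core

/-- **GC for three relays, case `a₀ = 3` (the `K`-loneliest relay is the most reliable relay of the core), closed form.**
Inputs as in `gc3_middle`, with the exchange row `t₁ ≤ s₂₃`, the tie row `s₃ ≤ s₁ → t₃ ≤ s₁₂` (Lemma 3(ii) when `s₁ = s₂ = s₃`),
and the world expansion of `P_K(3↔b) ≤ P_K(1↔b)`.  Conclusion: `T(3) ≥ 0`.
[cite: KozmaNitzan2024, §3.2 Definition and Thm. 5 (pp. 12–14) — extension to two pendant stars, three relays] -/
theorem gc3_top {x₁ x₂ x₃ y₁ y₂ y₃ αx αy s₁ s₂ s₃ s₁₂ s₂₃ t₁ t₃ : ℝ}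
    (hx₁ : 0 ≤ x₁) (hx₁' : x₁ ≤ 1) (hx₂ : 0 ≤ x₂) (hx₂' : x₂ ≤ 1) (hx₃ : 0 ≤ x₃) (hx₃' : x₃ ≤ 1)
    (hy₁ : 0 ≤ y₁) (hy₁' : y₁ ≤ 1) (hy₂ : 0 ≤ y₂) (hy₂' : y₂ ≤ 1) (hy₃ : 0 ≤ y₃) (hy₃' : y₃ ≤ 1)
    (hαx : αx = (1 - x₁) * (1 - x₂) * (1 - x₃) + x₁ * (1 - x₂) * (1 - x₃) + (1 - x₁) * x₂ * (1 - x₃) + (1 - x₁) * (1 - x₂) * x₃)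
    (hαy : αy = (1 - y₁) * (1 - y₂) * (1 - y₃) + y₁ * (1 - y₂) * (1 - y₃) + (1 - y₁) * y₂ * (1 - y₃) + (1 - y₁) * (1 - y₂) * y₃)
    (h12 : s₁ ≤ s₂) (h23 : s₂ ≤ s₃) (hE1 : t₁ ≤ s₂₃) (htie : s₃ ≤ s₁ → t₃ ≤ s₁₂)
    (hyp : 0 ≤ αx * αy * (s₁ - s₃) + (x₁ * x₂ * (1 - x₃) * (αy + y₁ * y₂ * (1 - y₃)) + y₁ * y₂ * (1 - y₃) * αx) * (s₁₂ - t₃) +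
      ((1 - x₁) * x₂ * x₃ * (αy + (1 - y₁) * y₂ * y₃) + (1 - y₁) * y₂ * y₃ * αx) * (t₁ - s₂₃)) :
    0 ≤ (1 - (x₃ + y₃ - x₃ * y₃)) * ((1 - (x₂ + y₂ - x₂ * y₂)) * (s₁ - s₃) +
      (x₂ + y₂ - x₂ * y₂) * (1 - (x₁ + y₁ - x₁ * y₁)) * (s₂ - s₃) + (x₁ + y₁ - x₁ * y₁) * (x₂ + y₂ - x₂ * y₂) * (s₁₂ - t₃)) := by
  have hαx0 : 0 ≤ αx := by rw [hαx]; exact alpha_nonneg hx₁ hx₁' hx₂ hx₂' hx₃ hx₃'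
  have hαy0 : 0 ≤ αy := by rw [hαy]; exact alpha_nonneg hy₁ hy₁' hy₂ hy₂' hy₃ hy₃'
  have hair := hairIneq_top hx₁ hx₁' hx₂ hx₂' hx₃ hx₃' hy₁ hy₁' hy₂ hy₂' hy₃ hy₃' hαx hαy
  have hdeg' := noHit3_le_qd_add_q12 hx₁ hx₁' hx₂ hx₂' hx₃ hx₃' hy₁ hy₁' hy₂ hy₂' hy₃ hy₃' hαx hαy
  have hq₁₂ : 0 ≤ x₁ * x₂ * (1 - x₃) * (αy + y₁ * y₂ * (1 - y₃)) + y₁ * y₂ * (1 - y₃) * αx := by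
    have t1 : 0 ≤ x₁ * x₂ * (1 - x₃) * (αy + y₁ * y₂ * (1 - y₃)) :=
      mul_nonneg (mul_nonneg (mul_nonneg hx₁ hx₂) (by linarith)) (add_nonneg hαy0 (mul_nonneg (mul_nonneg hy₁ hy₂) (by linarith)))
    have t2 : 0 ≤ y₁ * y₂ * (1 - y₃) * αx := mul_nonneg (mul_nonneg (mul_nonneg hy₁ hy₂) (by linarith)) hαx0
    linarith
  have hq₂₃ : 0 ≤ (1 - x₁) * x₂ * x₃ * (αy + (1 - y₁) * y₂ * y₃) + (1 - y₁) * y₂ * y₃ * αx := by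
    have t1 : 0 ≤ (1 - x₁) * x₂ * x₃ * (αy + (1 - y₁) * y₂ * y₃) :=
      mul_nonneg (mul_nonneg (mul_nonneg (by linarith) hx₂) hx₃) (add_nonneg hαy0 (mul_nonneg (mul_nonneg (by linarith) hy₂) hy₃))
    have t2 : 0 ≤ (1 - y₁) * y₂ * y₃ * αx := mul_nonneg (mul_nonneg (mul_nonneg (by linarith) hy₂) hy₃) hαx0
    linarith
  have hH₁ : 0 ≤ x₁ + y₁ - x₁ * y₁ := merged_nonneg hx₁ hy₁ hy₁'
  have hH₁' : x₁ + y₁ - x₁ * y₁ ≤ 1 := merged_le_one hx₁' hy₁'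
  have hH₂ : 0 ≤ x₂ + y₂ - x₂ * y₂ := merged_nonneg hx₂ hy₂ hy₂'
  have hH₂' : x₂ + y₂ - x₂ * y₂ ≤ 1 := merged_le_one hx₂' hy₂'
  have hH₃' : x₃ + y₃ - x₃ * y₃ ≤ 1 := merged_le_one hx₃' hy₃'
  have hqd0 : 0 ≤ αx * αy := mul_nonneg hαx0 hαy0
  have hα : 0 ≤ s₃ - s₁ := by linarith
  have hβ : 0 ≤ s₃ - s₂ := sub_nonneg.2 h23
  have hβα : s₃ - s₂ ≤ s₃ - s₁ := by linarith
  have hδ : 0 ≤ s₂₃ - t₁ := sub_nonneg.2 hE1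
  have hyp' : αx * αy * (s₃ - s₁) +
      ((1 - x₁) * x₂ * x₃ * (αy + (1 - y₁) * y₂ * y₃) + (1 - y₁) * y₂ * y₃ * αx) * (s₂₃ - t₁) ≤
        (x₁ * x₂ * (1 - x₃) * (αy + y₁ * y₂ * (1 - y₃)) + y₁ * y₂ * (1 - y₃) * αx) * (s₁₂ - t₃) := by
    linarith [hyp]
  have htie' : s₃ - s₁ = 0 → 0 ≤ s₁₂ - t₃ := fun h => by have := htie (by linarith); linarith
  have core := gc3_top_arith hH₁ hH₁' hH₂ hH₂' hH₃' hqd0 hq₁₂ hq₂₃ hα hβ hβα hδ hyp' hair hdeg' htie'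
  have e : (1 - (x₃ + y₃ - x₃ * y₃)) * ((1 - (x₂ + y₂ - x₂ * y₂)) * (s₁ - s₃) +
      (x₂ + y₂ - x₂ * y₂) * (1 - (x₁ + y₁ - x₁ * y₁)) * (s₂ - s₃) + (x₁ + y₁ - x₁ * y₁) * (x₂ + y₂ - x₂ * y₂) * (s₁₂ - t₃)) =
      (1 - (x₃ + y₃ - x₃ * y₃)) * (-((1 - (x₂ + y₂ - x₂ * y₂)) * (s₃ - s₁)) -
        (x₂ + y₂ - x₂ * y₂) * (1 - (x₁ + y₁ - x₁ * y₁)) * (s₃ - s₂) + (x₁ + y₁ - x₁ * y₁) * (x₂ + y₂ - x₂ * y₂) * (s₁₂ - t₃)) := by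
    ring
  rw [e]; exact core

end KNGoodGC3

end Summit.CriticalPhenomena.PercolationContinuityZ3.Theorems
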